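import Summits.Parity.GeneralizedHardyLittlewood.Theorems.PrimeLevelFamEdgeIdeaDeltasPairsSplit
import Literature.NumberTheory.LFunctions.KMVMollifierDiagonalMainTerm
import Literature.NumberTheory.LFunctions.Bettin2017PrimeLevelHolds
import HarnessLib

/-!
# Route `PrimeLevelFamEdge`, crux K_A `MomentsBeyondDiagonal` (stmt-Parity-20007), line «petersson_layers» v4:
# the `Q = 1` slice of `stub_first : SubFirst` is a THEOREM of the tree (lead prover, 2026-08-28; helper)

`SubFirst` (deck 15 `…PairsSplit`) asks for the first KMV display `L^h(P,Q)(q̂^{Δ'}) = ζ(2)√q̂/(Δ' log q̂)·(lin + T₁) +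
O(√q̂ log⁻² q̂)` for every admissible `P`, EVERY even-or-odd `Q`, on some window beyond the diagonal. At `Q = 1` (the only value
the route's deciding theorem `closes`, the value crux `BeyondDiagonalBeatsQuarter` and the conversion consume) it holds
UNCONDITIONALLY on the whole range `0 < Δ' < 2` with `T₁ = 0`: Bettin's prime-level first moment is a tree theorem
(`bettin2017_theorem11_primeLevel_holds`, from the proved Petersson formula) and the mollifier main term is discharged for every
admissible `P` (`KMV2000.mollifierMainTermAsymp_of_admissible`), combined in `KMV2000.firstDisplay_of_bettin'`. This file records the
composition by name, as the `Q = 1` companion of `tailNearFar_atOne` (the `Q = 1` slice of `stub_identP`,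
`…MomentsBeyondDiagonalIdentificationAtOne`). The `Q ≠ 1` slices of `stub_first` wait on the first-moment AFE with derivatives
(KMV (13)–(15)), not yet in the tree. Nothing here is about `stub_core` / K_A; no exceptional-zero claim (no GRH, no Landau–Siegel).
-/

noncomputable section

open scoped Real
open Complex Polynomial
open Literature.NumberTheory.LFunctions

namespace Summit.Parity.GeneralizedHardyLittlewood.Theorems.PrimeLevelFamEdgeIdeaDeltas.PairsSplit

/-- **The first display at `Q = 1`, unconditional, on `0 < Δ' < 2` (so on every window beyond the diagonal below length `2`):**
for admissible `P` there are `C, q₀` with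
`‖L^h(P,1)(q̂^{Δ'}) − ζ(2)·(√q̂/(Δ' log q̂))·(linForm Δ' P 1 + 0)‖ ≤ C √q̂ (log q̂)⁻²` for all primes `q ≥ q₀` — the `Q = 1` slice of
`stub_first : SubFirst` with `T₁ = 0`, by `KMV2000.firstDisplay_of_bettin'` and `bettin2017_theorem11_primeLevel_holds`. -/
theorem firstDisplay_atOne {P : ℝ[X]} (hP : KMV2000.Admissible P) {Δ' : ℝ} (h0 : 0 < Δ') (h2 : Δ' < 2) :
    ∃ C : ℝ, ∃ q₀ : ℕ, ∀ (q : ℕ) [NeZero q], q.Prime → q₀ ≤ q →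
      ‖KMV2000.LhPQ q P 1 (KMV2000.qhat q ^ Δ') -
          ((riemannZeta 2 * ((Real.sqrt (KMV2000.qhat q) / (Δ' * Real.log (KMV2000.qhat q)) : ℝ) : ℂ)) *
            ((KMV2000.linForm Δ' P 1 + 0 : ℝ) : ℂ))‖ ≤
        C * Real.sqrt (KMV2000.qhat q) * (Real.log (KMV2000.qhat q))⁻¹ ^ 2 :=
  KMV2000.firstDisplay_of_bettin' bettin2017_theorem11_primeLevel_holds hP h0 h2

/-- The same in the quantifier shape of `FirstMomentBeyond Δ T₁` restricted to `Q = 1`, with `T₁ = 0` and ANY window end `Δ < 2`: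
for every admissible `P` and every `Δ' ∈ (1, Δ]` the first display holds (the genericity side condition `q̂^{Δ'} ∉ ℕ` of the
registered shape is not even needed). -/
theorem firstMomentBeyond_atOne {Δ : ℝ} (hΔ : Δ < 2) :
    ∀ P : ℝ[X], KMV2000.Admissible P → ∀ Δ' : ℝ, 1 < Δ' → Δ' ≤ Δ →
      ∃ C : ℝ, ∃ q₀ : ℕ, ∀ (q : ℕ) [NeZero q], q.Prime → q₀ ≤ q →
        (∀ n : ℕ, (n : ℝ) ≠ KMV2000.qhat q ^ Δ') →
          ‖KMV2000.LhPQ q P 1 (KMV2000.qhat q ^ Δ') -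
              ((riemannZeta 2 * ((Real.sqrt (KMV2000.qhat q) / (Δ' * Real.log (KMV2000.qhat q)) : ℝ) : ℂ)) *
                ((KMV2000.linForm Δ' P 1 + (fun _ _ _ ↦ (0 : ℝ)) Δ' P 1 : ℝ) : ℂ))‖ ≤
            C * Real.sqrt (KMV2000.qhat q) * (Real.log (KMV2000.qhat q))⁻¹ ^ 2 := by
  intro P hP Δ' h1 h2
  obtain ⟨C, q₀, h⟩ := firstDisplay_atOne hP (by linarith) (by linarith)
  exact ⟨C, q₀, fun q _ hq hq₀ _ ↦ h q hq hq₀⟩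

end Summit.Parity.GeneralizedHardyLittlewood.Theorems.PrimeLevelFamEdgeIdeaDeltas.PairsSplit

end
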